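import Mathlib
import Literature.NumberTheory.Automorphic.HilbertModularFormQExpansion
import Summits.Langlands.Langlands.Theorems.CapacityClassicalityHilbertIntegralOverconvergentIsCongruenceThetaSeed

/-!
# The weight-one theta seed: `Seed.ItemNonconstantForm 1` (line Sketch-ideate-r1-k1, § W, RESHAPE 19)

Lead's file for RESHAPE 19 (§ W) of line Sketch-ideate-r1-k1 of the crux `HilbertIntegralOverconvergentIsCongruence`
(stmt-Langlands-8485): over every totally real field `F` of degree `≥ 2`, `Θ² · 1_ℍ`
(`Θ(z) = ∑_{x ∈ 𝓞F} e^{2πi S(x² z)}`) is a Hilbert modular form of PARALLEL WEIGHT ONE and level `Γ₁((4 d_F))`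
with natural-number Fourier coefficients `a_ν = #{(x, y) ∈ 𝓞F² : x² + y² = ν}`, `a₁ ≥ 2` (`thetaSeedOne`).  Hence
`Seed.ItemNonconstantForm 1`, and with § U the typed crux holds for EVERY parallel weight `k ∈ ℤ·𝟙` from the two
`q`-expansion-principle items (i′), (i″) alone.

Everything is parallel to § V (`…ThetaSeed.lean`, weight `2`, `Θ⁴`), with the exponent `2` replaced by `1`:
* `tw_lower_unipotent_of_inversion_pow`, `tw_gamma1_law_pow`: the parallel-weight-`m` law on `Γ₁((q))` from
  `𝓞F`-periodicity and an inversion formula `Φ(-1/w) = C ∏_σ w_σ^m Ψ(w)` with `(q)`-periodic `Ψ` (stubs V5–V7 of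
  the line, Vaserstein generation);
* `tw_theta2_inversion`: `Θ(-1/w)² = |d_F|^{-1} (2i)^{-d} ∏_σ w_σ · Θ'(w/4)²` on `ℍ^d` (Hecke's formula on the
  imaginary orthant, stub V3, squared — no branch of the square root is needed —, propagated by the identity
  principle, stub V4);
* cusps by the landed Koecher principle; coefficients by `ts_natCoeff_mul`.
-/

set_option linter.dupNamespace false

noncomputable section

namespace Summit.Langlands.Langlands.Theorems.HilbertIntegralOverconvergentIsCongruence

open MeasureTheory Complex NumberField
open Literature.NumberTheory.Automorphic Literature.NumberTheory.Automorphic.HilbertModular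
open scoped MatrixGroups

/-- The parallel-weight-`m` automorphy factor of `E₂₁(a) = (1 0; a 1) ∈ SL₂(F)`: `∏_σ (σ(a) z_σ + 1)^m`. [folklore] -/
theorem tw_autFactor_e21_pow {F : Type} [Field F] [NumberField F] (m : ℕ) (a : F) (z : Point F) :
    autFactor (fun _ ↦ (m : ℤ)) (SL2Rel.e21 a) z = ∏ σ : F →+* ℝ, (((σ a : ℝ) : ℂ) * z σ + 1) ^ m := by
  simp only [autFactor, lui_denom_e21, zpow_natCast]

/-- Weight-`m` version of the heart of stub V5, at the point `z = -1/w`, `w ∈ ℍ`, for `E₂₁(a) ∈ SL₂(F)`: if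
`Φ(-1/w) = C ∏_σ w_σ^m Ψ(w)` on `ℍ` and `Ψ(w + a) = Ψ(w)` on `ℍ`, then `Φ(E₂₁(a) z) = J_m(E₂₁(a), z) Φ(z)`
(`E₂₁(a) z = -1/(w - a)`, `σ(a) z_σ + 1 = (w_σ - σ(a))/w_σ`; adapted from `lui_law_e21_at_neg_inv`). [folklore] -/
theorem tw_law_e21_at_neg_inv_pow {F : Type} [Field F] [NumberField F] (m : ℕ) (Φ Ψ : Point F → ℂ) (C : ℂ)
    (a : F) (hinv : ∀ w ∈ halfSpace F, Φ (fun σ ↦ -(w σ)⁻¹) = C * (∏ σ : F →+* ℝ, w σ ^ m) * Ψ w)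
    (hper : ∀ w ∈ halfSpace F, Ψ (fun σ ↦ w σ + ((σ a : ℝ) : ℂ)) = Ψ w) {w : Point F}
    (hw : w ∈ halfSpace F) :
    Φ (moeb (SL2Rel.e21 a) fun σ ↦ -(w σ)⁻¹) =
      autFactor (fun _ ↦ (m : ℤ)) (SL2Rel.e21 a) (fun σ ↦ -(w σ)⁻¹) * Φ fun σ ↦ -(w σ)⁻¹ := by
  have hw0 : ∀ σ, w σ ≠ 0 := lui_ne_zero_of_mem_halfSpace hw
  have hw' : (fun σ ↦ w σ - ((σ a : ℝ) : ℂ)) ∈ halfSpace F := lui_sub_real_im_pos hw fun σ ↦ σ a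
  have hkey : ∀ σ, ((σ a : ℝ) : ℂ) * -(w σ)⁻¹ + 1 = (w σ - ((σ a : ℝ) : ℂ)) / w σ := fun σ ↦ by
    rw [sub_div, div_self (hw0 σ), div_eq_mul_inv]
    ring
  have hmoeb : (moeb (SL2Rel.e21 a) fun σ ↦ -(w σ)⁻¹) = fun σ ↦ -(w σ - ((σ a : ℝ) : ℂ))⁻¹ := by
    funext σ
    simp only [lui_moeb_e21]
    rw [hkey σ, div_div_eq_mul_div, neg_mul, inv_mul_cancel₀ (hw0 σ), neg_div, one_div]
  have haut : autFactor (fun _ ↦ (m : ℤ)) (SL2Rel.e21 a) (fun σ ↦ -(w σ)⁻¹) =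
      ∏ σ : F →+* ℝ, ((w σ - ((σ a : ℝ) : ℂ)) / w σ) ^ m := by
    simp only [tw_autFactor_e21_pow]
    exact Finset.prod_congr rfl fun σ _ ↦ by rw [hkey σ]
  have hΨ : Ψ (fun σ ↦ w σ - ((σ a : ℝ) : ℂ)) = Ψ w := by
    have h := hper _ hw'
    simp only [sub_add_cancel] at h
    exact h.symm
  have hprod : (∏ σ : F →+* ℝ, ((w σ - ((σ a : ℝ) : ℂ)) / w σ) ^ m) * ∏ σ : F →+* ℝ, w σ ^ m =
      ∏ σ : F →+* ℝ, (w σ - ((σ a : ℝ) : ℂ)) ^ m := by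
    rw [← Finset.prod_mul_distrib]
    refine Finset.prod_congr rfl fun σ _ ↦ ?_
    rw [← mul_pow, div_mul_cancel₀ _ (hw0 σ)]
  rw [hmoeb, hinv _ hw', haut, hinv w hw, hΨ, ← hprod]
  ring

/-- **The lower unipotent law in parallel weight `m` from an inversion formula**: if
`Φ(-1/w) = C ∏_σ w_σ^m Ψ(w)` on `ℍ` and `Ψ` is `J`-periodic on `ℍ`, then
`Φ((1 0; c 1) z) = ∏_σ (σ(c) z_σ + 1)^m Φ(z)` for `c ∈ J`, `z ∈ ℍ` (weight-`m` version of stub V5). [folklore] -/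
theorem tw_lower_unipotent_of_inversion_pow (F : Type) [Field F] [NumberField F] (m : ℕ) (Φ Ψ : Point F → ℂ)
    (C : ℂ) (J : Ideal (𝓞 F))
    (hinv : ∀ w ∈ halfSpace F, Φ (fun σ ↦ -(w σ)⁻¹) = C * (∏ σ : F →+* ℝ, w σ ^ m) * Ψ w)
    (hper : ∀ c ∈ J, ∀ w ∈ halfSpace F, Ψ (fun σ ↦ w σ + ((σ (c : F) : ℝ) : ℂ)) = Ψ w) :
    ∀ c ∈ J, ∀ z ∈ halfSpace F,
      Φ (moeb (toSL2F (SL2Rel.e21 c)) z) = autFactor (fun _ ↦ (m : ℤ)) (toSL2F (SL2Rel.e21 c)) z * Φ z := by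
  intro c hc z hz
  have hzw : z = fun σ ↦ -((fun τ ↦ -(z τ)⁻¹) σ)⁻¹ := funext fun σ ↦ by simp
  rw [lui_toSL2F_e21, hzw]
  exact tw_law_e21_at_neg_inv_pow m Φ Ψ C (c : F) hinv (hper c hc) (lui_neg_inv_mem_halfSpace hz)

/-- **The parallel-weight-`m` law on `Γ₁((q))` from periodicity and an inversion formula** (weight-`m` version of
`ts_gamma1_law`: translations by periodicity, lower unipotents by `tw_lower_unipotent_of_inversion_pow`, the
generated subgroup by stub V7, `Γ₁((q))` inside it by Vaserstein, stub V6). [folklore] -/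
theorem tw_gamma1_law_pow (F : Type) [Field F] [NumberField F] [NumberField.IsTotallyReal F]
    (hd : 1 < Module.finrank ℚ F) (q : 𝓞 F) (hq : q ≠ 0) (m : ℕ) (Φ Ψ : Point F → ℂ) (C : ℂ)
    (hperΦ : ∀ (b : 𝓞 F) (z : Point F), z ∈ halfSpace F → Φ (fun σ ↦ z σ + ((σ (b : F) : ℝ) : ℂ)) = Φ z)
    (hinv : ∀ w ∈ halfSpace F, Φ (fun σ ↦ -(w σ)⁻¹) = C * (∏ σ : F →+* ℝ, w σ ^ m) * Ψ w)
    (hperΨ : ∀ c ∈ Ideal.span {q}, ∀ w ∈ halfSpace F, Ψ (fun σ ↦ w σ + ((σ (c : F) : ℝ) : ℂ)) = Ψ w) :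
    ∀ γ ∈ Bianchi.Gamma1 (Ideal.span {q}), ∀ z ∈ halfSpace F,
      Φ (moeb (toSL2F γ) z) = autFactor (fun _ ↦ (m : ℤ)) (toSL2F γ) z * Φ z := by
  intro γ hγ
  have hgen : ∀ γ ∈ (Set.range fun b : 𝓞 F ↦ SL2Rel.e12 b) ∪ (SL2Rel.e21 '' (Ideal.span {q} : Set (𝓞 F))),
      ∀ z ∈ halfSpace F, Φ (moeb (toSL2F γ) z) = autFactor (fun _ ↦ (m : ℤ)) (toSL2F γ) z * Φ z := by
    rintro γ (⟨b, rfl⟩ | ⟨c, hc, rfl⟩) z hz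
    · obtain ⟨hmoeb, haut⟩ := kp_moeb_transl (cpc_coe_toSL2F_e12 b) (fun _ ↦ (m : ℤ)) z
      rw [hmoeb, haut, one_mul, hperΦ b z hz]
    · exact tw_lower_unipotent_of_inversion_pow F m Φ Ψ C (Ideal.span {q}) hinv hperΨ c hc z hz
  exact stub_transform_of_closure F (fun _ ↦ (m : ℤ)) Φ _ hgen γ (stub_gamma1_le_closure F hd q hq hγ)

/-- **Theta inversion for `Θ²` on `ℍ^d`.** For `w ∈ ℍ`:
`Θ(-1/w)² = |d_F|^{-1} (2i)^{-d} ∏_σ w_σ · Θ'(w/4)²` (`Θ`, `Θ'` as in `ts_theta4_inversion`): both sides are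
holomorphic on `ℍ^d` and agree on the imaginary orthant by Hecke's formula (stub V3 squared — no square-root
ambiguity), hence everywhere (stub V4). [cite: NeukirchANT1999, Ch. VII (3.6), (5.7)] -/
theorem tw_theta2_inversion (F : Type) [Field F] [NumberField F] [NumberField.IsTotallyReal F] :
    ∀ w ∈ halfSpace F,
      (∑' x : 𝓞 F, cexp (2 * Real.pi * I * pairing (((x : 𝓞 F) : F) ^ 2) (fun σ ↦ -(w σ)⁻¹))) ^ 2 =
        (((|(NumberField.discr F : ℝ)| ^ (-(1 / 2 : ℝ)) : ℝ) : ℂ) ^ 2 * ∏ _σ : F →+* ℝ, (2 * I)⁻¹) *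
          (∏ σ : F →+* ℝ, w σ ^ 1) *
          (∑' ξ : {ν : F | ∀ a : 𝓞 F, ∃ n : ℤ, Algebra.trace ℚ F (ν * a) = n},
              cexp (2 * Real.pi * I * pairing ((ξ : F) ^ 2) (fun σ ↦ w σ / 4))) ^ 2 := by
  obtain ⟨hgauss, habs, hθQ, -, -, -, -⟩ := stub_theta_qSeries F
  obtain ⟨hθ'hol, -⟩ := stub_thetaDual_props F hgauss
  set D : Set F := {ν : F | ∀ a : 𝓞 F, ∃ n : ℤ, Algebra.trace ℚ F (ν * a) = n} with hD
  set θ : Point F → ℂ :=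
    fun z ↦ ∑' x : 𝓞 F, cexp (2 * Real.pi * I * pairing (((x : 𝓞 F) : F) ^ 2) z) with hθ
  set θ' : Point F → ℂ := fun z ↦ ∑' ξ : D, cexp (2 * Real.pi * I * pairing ((ξ : F) ^ 2) z) with hθ'
  set A : ℂ := ((|(NumberField.discr F : ℝ)| ^ (-(1 / 2 : ℝ)) : ℝ) : ℂ) with hA
  set C : ℂ := A ^ 2 * ∏ _σ : F →+* ℝ, (2 * I)⁻¹ with hC
  have hθhol : IsHolomorphicOn F θ :=
    ts_isHolomorphicOn_congr hθQ
      (qSeriesPackage F (fun ν ↦ ((Nat.card {x : 𝓞 F // ((x : 𝓞 F) : F) ^ 2 = ν} : ℕ) : ℂ)) habs).1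
  set f₁ : Point F → ℂ := fun w ↦ (θ (fun σ ↦ -(w σ)⁻¹)) ^ 2 with hf₁
  set g₁ : Point F → ℂ := fun w ↦ C * (∏ σ : F →+* ℝ, w σ ^ 1) * (θ' (fun σ ↦ w σ / 4)) ^ 2 with hg₁
  have h1 : IsHolomorphicOn F f₁ :=
    (hθhol.comp (ts_differentiableOn_neg_inv F) fun w hw ↦ ts_neg_inv_mem_halfSpace hw).pow 2
  have h2 : IsHolomorphicOn F g₁ := by
    obtain ⟨hqmaps, hqdiff⟩ := ts_quarter_props F
    have h : DifferentiableOn ℂ (fun w : Point F ↦ θ' (fun σ ↦ w σ / 4)) (halfSpace F) :=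
      hθ'hol.comp hqdiff.differentiableOn fun w hw ↦ hqmaps w hw
    have hp : Differentiable ℂ (fun w : Point F ↦ ∏ σ : F →+* ℝ, w σ ^ 1) := by
      simp only [pow_one]
      intro w
      classical
      have := HasFDerivAt.finsetProd (u := Finset.univ)
        (fun σ _ ↦ (differentiableAt_apply (𝕜 := ℂ) σ w).hasFDerivAt)
      simpa [Finset.prod_fn] using this.differentiableAt
    exact ((differentiableOn_const C).mul hp.differentiableOn).mul (h.pow 2)
  have h3 : ∀ y : (F →+* ℝ) → ℝ, (∀ σ, 0 < y σ) →
      f₁ (fun σ ↦ ((y σ : ℝ) : ℂ) * I) = g₁ (fun σ ↦ ((y σ : ℝ) : ℂ) * I) := by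
    intro y hy
    set y' : (F →+* ℝ) → ℝ := fun σ ↦ y σ / 4 with hy'
    have hy'pos : ∀ σ, 0 < y' σ := fun σ ↦ div_pos (hy σ) four_pos
    have hV3 := stub_theta_inversion_imaginary F y' hy'pos
    have hpt1 : (fun σ ↦ -((((y σ : ℝ) : ℂ)) * I)⁻¹) = fun σ ↦ ((((4 * y' σ)⁻¹ : ℝ) : ℂ)) * I := by
      funext σ
      have h4 : (4 : ℝ) * y' σ = y σ := by rw [hy']; ring
      rw [h4, mul_inv, Complex.inv_I]
      push_cast
      ring
    have hpt2 : (fun σ ↦ ((y σ : ℝ) : ℂ) * I / 4) = fun σ ↦ ((y' σ : ℝ) : ℂ) * I := by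
      funext σ; rw [hy']; push_cast; ring
    have hP : (∏ σ : F →+* ℝ, ((Real.sqrt (2 * y' σ) : ℝ) : ℂ)) ^ 2 =
        (∏ _σ : F →+* ℝ, (2 * I)⁻¹) * ∏ σ : F →+* ℝ, (((y σ : ℝ) : ℂ) * I) ^ 1 := by
      rw [← Finset.prod_pow, ← Finset.prod_mul_distrib]
      refine Finset.prod_congr rfl fun σ _ ↦ ?_
      have h2 : (0 : ℝ) ≤ 2 * y' σ := (mul_pos two_pos (hy'pos σ)).le
      rw [← Complex.ofReal_pow, Real.sq_sqrt h2, pow_one, hy', mul_inv]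
      field_simp
      push_cast
      ring_nf
    simp only [hf₁, hg₁, hθ, hθ']
    rw [hpt1, hV3, hpt2, mul_pow, mul_pow, hP]
    ring
  intro w hw
  have key := stub_imaginary_orthant_identity F f₁ g₁ h1 h2 h3 w hw
  simpa only [hf₁, hg₁] using key

/-- **`Θ²` as a Hilbert modular form of parallel weight one (data).** Over every totally real field `F` of degree
`≥ 2` there is a Hilbert modular form of parallel weight `1` with integer Fourier coefficients and non-zero
coefficients at the indices `0` and `1`: `Θ² · 1_ℍ` of level `Γ₁((4 d_F))` (coefficients `a_ν(Θ²) = #{(x,y) : x² + y² = ν}`,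
`a₁ ≥ r(0) r(1) = 2`; the weight-`1` law from `tw_theta2_inversion` and `tw_gamma1_law_pow`; cusps by Koecher).
Consequently the typed crux holds for EVERY parallel weight from the items (i′), (i″) alone. [folklore] -/
theorem thetaTwoData (F : Type) [Field F] [NumberField F] [NumberField.IsTotallyReal F]
    (hd : 1 < Module.finrank ℚ F) :
    ∃ 𝔫 : Ideal (𝓞 F), 𝔫 ≠ ⊥ ∧ ∃ (h : Point F → ℂ) (zc : F → ℤ),
      h ∈ modularForms (Bianchi.Gamma1 𝔫) (fun _ ↦ (1 : ℤ)) ∧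
      (∀ ν ∈ qIndexSet F, fourierCoeff h ν = (zc ν : ℂ)) ∧
      fourierCoeff h 0 ≠ 0 ∧ fourierCoeff h 1 ≠ 0 := by
  classical
  obtain ⟨hgauss, habs, hθQ, hr0, hr1, hrsupp, hθper⟩ := stub_theta_qSeries F
  obtain ⟨-, hθ'per⟩ := stub_thetaDual_props F hgauss
  set D : Set F := {ν : F | ∀ a : 𝓞 F, ∃ n : ℤ, Algebra.trace ℚ F (ν * a) = n} with hD
  set r : F → ℕ := fun ν ↦ Nat.card {x : 𝓞 F // ((x : 𝓞 F) : F) ^ 2 = ν} with hr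
  set θ : Point F → ℂ :=
    fun z ↦ ∑' x : 𝓞 F, cexp (2 * Real.pi * I * pairing (((x : 𝓞 F) : F) ^ 2) z) with hθ
  set θ' : Point F → ℂ := fun z ↦ ∑' ξ : D, cexp (2 * Real.pi * I * pairing ((ξ : F) ^ 2) z) with hθ'
  obtain ⟨hθhol, hθperH, hθcoeff⟩ := ts_natCoeff_of_qSeries F r θ habs hθQ
  have hrz : ∀ μ : F, μ ∈ D → μ ∉ qIndexSet F → r μ = 0 := fun μ _ hμc ↦ by
    by_contra h
    exact hμc (hrsupp μ h)
  obtain ⟨c₂, hc₂, -, hle₂⟩ :=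
    ts_natCoeff_mul F θ θ hθhol hθhol hθperH hθperH r r hθcoeff hrz hθcoeff hrz
  have h1q : (1 : F) ∈ qIndexSet F := hcm_one_mem_qIndexSet F
  have h0q : (0 : F) ∈ qIndexSet F := zero_mem_qIndexSet
  have hc₂pos : 2 ≤ c₂ 1 := by
    have hr0' : r 0 = 1 := hr0
    have hr1' : r 1 = 2 := hr1
    have h01 : r 0 * r 1 ≤ c₂ 1 := by simpa using hle₂ 0 h0q 1 h1q
    rw [hr0', hr1'] at h01
    simpa using h01
  have hθ2 : θ ^ 2 = θ * θ := pow_two θ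
  -- level and transformation law
  set dF : 𝓞 F := ((NumberField.discr F : ℤ) : 𝓞 F) with hdF
  set q : 𝓞 F := 4 * dF with hq
  have hdFmem : dF ∈ differentIdeal ℤ (𝓞 F) := NumberField.discr_mem_differentIdeal F (𝓞 F)
  have hdF0 : dF ≠ 0 := by
    rw [hdF]
    exact Int.cast_ne_zero.2 (NumberField.discr_ne_zero F)
  have hq0 : q ≠ 0 := mul_ne_zero (by norm_num) hdF0
  have hJ : Ideal.span {q} ≠ ⊥ := by rwa [Ne, Ideal.span_singleton_eq_bot]
  set A : ℂ := ((|(NumberField.discr F : ℝ)| ^ (-(1 / 2 : ℝ)) : ℝ) : ℂ) with hA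
  set C : ℂ := A ^ 2 * ∏ _σ : F →+* ℝ, (2 * I)⁻¹ with hC
  set Ψ : Point F → ℂ := fun w ↦ (θ' (fun σ ↦ w σ / 4)) ^ 2 with hΨ
  have hperΦ : ∀ (b : 𝓞 F) (z : Point F), z ∈ halfSpace F →
      (θ ^ 2) (fun σ ↦ z σ + ((σ (b : F) : ℝ) : ℂ)) = (θ ^ 2) z := fun b z _ ↦ by
    simp only [Pi.pow_apply, hθ, hθper b z]
  have hinv : ∀ w ∈ halfSpace F, (θ ^ 2) (fun σ ↦ -(w σ)⁻¹) = C * (∏ σ : F →+* ℝ, w σ ^ 1) * Ψ w :=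
    fun w hw ↦ tw_theta2_inversion F w hw
  have hperΨ : ∀ c ∈ Ideal.span {q}, ∀ w ∈ halfSpace F,
      Ψ (fun σ ↦ w σ + ((σ (c : F) : ℝ) : ℂ)) = Ψ w := by
    intro c hc w _
    obtain ⟨t, rfl⟩ := Ideal.mem_span_singleton'.1 hc
    have hmem : t * dF ∈ differentIdeal ℤ (𝓞 F) := Ideal.mul_mem_left _ t hdFmem
    have hpt : (fun σ ↦ (w σ + ((σ ((t * q : 𝓞 F) : F) : ℝ) : ℂ)) / 4) =
        fun σ ↦ w σ / 4 + ((σ ((t * dF : 𝓞 F) : F) : ℝ) : ℂ) := by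
      funext σ
      rw [hq, hdF]
      push_cast
      simp only [map_mul, map_intCast, map_ofNat]
      push_cast
      ring
    have key := hθ'per (t * dF) hmem (fun σ ↦ w σ / 4)
    simp only [hΨ, hθ']
    rw [hpt]
    beta_reduce at key ⊢
    rw [key]
  have hlaw := tw_gamma1_law_pow F hd q hq0 1 (θ ^ 2) Ψ C hperΦ hinv hperΨ
  -- the form
  set f : Point F → ℂ := (halfSpace F).indicator (θ ^ 2) with hf
  have hfeq : ∀ z ∈ halfSpace F, f z = (θ ^ 2) z := fun z hz ↦ Set.indicator_of_mem hz _
  have hθ2hol : IsHolomorphicOn F (θ ^ 2) := by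
    change DifferentiableOn ℂ (fun z ↦ θ z ^ 2) (halfSpace F)
    exact hθhol.pow 2
  have hfhol : IsHolomorphicOn F f := ts_isHolomorphicOn_congr hfeq hθ2hol
  have hftrans : ∀ γ ∈ Bianchi.Gamma1 (Ideal.span {q}), ∀ z ∈ halfSpace F,
      f (moeb (toSL2F γ) z) = autFactor (fun _ ↦ (1 : ℤ)) (toSL2F γ) z * f z := fun γ hγ z hz ↦ by
    rw [hfeq z hz, hfeq _ (slm_moeb_mem_halfSpace _ hz), hlaw γ hγ z hz, Nat.cast_one]
  have hfzero : ∀ z ∉ halfSpace F, f z = 0 := fun z hz ↦ Set.indicator_of_notMem hz _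
  have hmod : IsModularForm (Bianchi.Gamma1 (Ideal.span {q})) (fun _ ↦ (1 : ℤ)) f :=
    koecherPrinciple F hd (Ideal.span {q}) hJ _ (Bianchi.Gamma_le_Gamma1 _) _ f hfhol hftrans hfzero
  have hfcoeff : ∀ ν : F, ν ∈ D → fourierCoeff f ν = (c₂ ν : ℂ) := fun ν hν ↦ by
    rw [ts_fourierCoeff_congr hfeq ν, hθ2]
    exact hc₂ ν hν
  have hc₂zero : 1 ≤ c₂ 0 := by
    have hr0' : r 0 = 1 := hr0
    have h00 : r 0 * r 0 ≤ c₂ 0 := by simpa using hle₂ 0 h0q 0 h0q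
    rw [hr0'] at h00
    simpa using h00
  refine ⟨Ideal.span {q}, hJ, f, fun ν ↦ (c₂ ν : ℤ), mem_modularForms_iff.2 hmod, fun ν hν ↦ ?_, ?_, ?_⟩
  · rw [hfcoeff ν hν.1, Int.cast_natCast]
  · rw [hfcoeff 0 h0q.1]
    exact Nat.cast_ne_zero.2 (by omega)
  · rw [hfcoeff 1 h1q.1]
    exact Nat.cast_ne_zero.2 (by omega)

/-- **The weight-one theta seed (`Seed.ItemNonconstantForm 1`).** Over every totally real field `F` of degree `≥ 2`
there is a Hilbert modular form of parallel weight ONE with integer Fourier coefficients and a non-zero coefficient at a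
non-zero index (`Θ² · 1_ℍ` of level `Γ₁((4 d_F))`, `thetaTwoData`, index `ν = 1`).  Consequently the typed crux holds
for EVERY parallel weight from the items (i′), (i″) alone. [folklore] -/
theorem thetaSeedOne (F : Type) [Field F] [NumberField F] [NumberField.IsTotallyReal F]
    (hd : 1 < Module.finrank ℚ F) :
    ∃ 𝔫 : Ideal (𝓞 F), 𝔫 ≠ ⊥ ∧ ∃ (h : Point F → ℂ) (zc : F → ℤ),
      h ∈ modularForms (Bianchi.Gamma1 𝔫) (fun _ ↦ (1 : ℤ)) ∧
      (∀ ν ∈ qIndexSet F, fourierCoeff h ν = (zc ν : ℂ)) ∧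
      ∃ ν ∈ qIndexSet F, ν ≠ 0 ∧ fourierCoeff h ν ≠ 0 := by
  obtain ⟨𝔫, h𝔫, h, zc, hh, hzc, -, h1⟩ := thetaTwoData F hd
  exact ⟨𝔫, h𝔫, h, zc, hh, hzc, 1, hcm_one_mem_qIndexSet F, one_ne_zero, h1⟩

end Summit.Langlands.Langlands.Theorems.HilbertIntegralOverconvergentIsCongruence
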